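import Summits.AtomisticToContinuum.HydrodynamicLimit.Theorems.CollisionIsometryCLTMacroClosureStubBalanceB3
import Summits.AtomisticToContinuum.HydrodynamicLimit.Theorems.CollisionIsometryCLTMesoscopicLLNKernels
import HarnessLib

/-!
# Sub-goal `engine_hotCells` of the lead's `stub_engine` (line `IdeatorTwoGen1Sketch`, crux
`MacroClosure`, stmt-AtomisticToContinuum-14870): the hot cells carry exponentially little

Pure kinematics. For a configuration `w` of `n + 1` particles, a continuous kernel `φ ≥ 0` of unit
mass, a band floor `ρ̄ ≥ c₁ > 0` and `M ≥ 1`, the hot blocks `H = {x | M ρ̄(x) < Ē(x)}` satisfy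
`∫_H (ρ̄ + |m̄| + Ē + Ē √(Ē/ρ̄)) dx ≤ C √M e^{-λM/4} ⟨emp w, e^{λ|v|²}⟩` with `C = C(λ)`.

Proof. Write the block fields as finite sums with the weights `pᵢ(x) = (n+1)⁻¹ φ(xᵢ − x) ≥ 0`:
`ρ̄ = Σ pᵢ`, `m̄ = Σ pᵢ vᵢ`, `Ē = Σ pᵢ |vᵢ|²/2`. On a hot block put `t = √(Ē/ρ̄) > √M ≥ 1`.
Splitting the particles at `|vᵢ|² = t²`, the slow ones carry at most `t² ρ̄ / 2 = Ē/2` of the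
energy, so `Ē ≤ 2 Σ_{|vᵢ|² > t²} pᵢ |vᵢ|²/2` and hence `Ē t ≤ Σ_{|vᵢ|² > t²} pᵢ |vᵢ|² t`; for such
a fast particle `|vᵢ|² t ≤ (|vᵢ|² + |vᵢ|⁴)/2 ≤ K e^{(3λ/4)|vᵢ|²} ≤ K e^{-λM/4} e^{λ|vᵢ|²}`
(`K = K(λ)`, as `|vᵢ|² > t² > M`). Moreover `ρ̄ ≤ Ē`, `|m̄| ≤ Σ pᵢ|vᵢ| ≤ ρ̄/2 + Ē` and `Ē ≤ Ē t`,
so the integrand is at most `5 Ē t ≤ 5 K e^{-λM/4} Σ pᵢ(x) e^{λ|vᵢ|²}` on `H`; integrating over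
all of `𝕋³` (`∫ φ(xᵢ − x) dx = 1`, Haar invariance) gives the claim with `C = 5K` (`√M ≥ 1`).
No Hölder inequality and no fast/slow split at the level `M` are needed.
-/

noncomputable section

open MeasureTheory Filter Set Topology InformationTheory
open scoped ENNReal ContDiff

namespace Summit.AtomisticToContinuum.HydrodynamicLimit.Theorems.MacroClosureLine

open Literature.MathematicalPhysics.KineticTheory Literature.Analysis.FluidPDE
open Literature.Analysis.FunctionSpaces

namespace Barycentric

namespace HotCells

/-- There is `K = K(λ) > 0` with `(a + a²)/2 ≤ K exp((3λ/4) a)` for all `a ≥ 0`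
(from `1 + x ≤ eˣ` and `1 + x + x²/2 ≤ eˣ`; `K = 2/(3λ) + 16/(9λ²)` works). -/
theorem exists_half_add_sq_le {lam : ℝ} (hlam : 0 < lam) :
    ∃ K : ℝ, 0 < K ∧ ∀ a : ℝ, 0 ≤ a → (a + a ^ 2) / 2 ≤ K * Real.exp (3 * lam / 4 * a) := by
  set c : ℝ := 3 * lam / 4 with hc_def
  have hc : 0 < c := by positivity
  refine ⟨(1 / c + 2 / c ^ 2) / 2, by positivity, fun a ha => ?_⟩
  have h1 : c * a + 1 ≤ Real.exp (c * a) := Real.add_one_le_exp _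
  have h2 : 1 + c * a + (c * a) ^ 2 / 2 ≤ Real.exp (c * a) :=
    Real.quadratic_le_exp_of_nonneg (by positivity)
  have ha1 : a ≤ Real.exp (c * a) / c := by
    rw [le_div_iff₀ hc]; nlinarith
  have ha2 : a ^ 2 ≤ 2 * Real.exp (c * a) / c ^ 2 := by
    rw [le_div_iff₀ (by positivity)]; nlinarith
  calc (a + a ^ 2) / 2 ≤ (Real.exp (c * a) / c + 2 * Real.exp (c * a) / c ^ 2) / 2 := by gcongr
    _ = (1 / c + 2 / c ^ 2) / 2 * Real.exp (c * a) := by ring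

/-- A fast particle: if `t² ≤ a` and `M ≤ a` then `a t ≤ K e^{-λM/4} e^{λ a}`. -/
theorem fast_bound {lam K t a M : ℝ} (hlam : 0 < lam) (hK0 : 0 ≤ K)
    (hK : ∀ a : ℝ, 0 ≤ a → (a + a ^ 2) / 2 ≤ K * Real.exp (3 * lam / 4 * a))
    (hta : t ^ 2 ≤ a) (hMa : M ≤ a) :
    a * t ≤ K * Real.exp (-(lam * M / 4)) * Real.exp (lam * a) := by
  have ha : 0 ≤ a := le_trans (sq_nonneg t) hta
  have h1 : t ≤ (1 + a) / 2 := by nlinarith [sq_nonneg (t - 1), hta]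
  have h2 : a * t ≤ (a + a ^ 2) / 2 := by nlinarith [h1, ha]
  have h4 : Real.exp (3 * lam / 4 * a) ≤ Real.exp (-(lam * M / 4)) * Real.exp (lam * a) := by
    rw [← Real.exp_add]; exact Real.exp_le_exp.2 (by nlinarith)
  calc a * t ≤ (a + a ^ 2) / 2 := h2
    _ ≤ K * Real.exp (3 * lam / 4 * a) := hK a ha
    _ ≤ K * (Real.exp (-(lam * M / 4)) * Real.exp (lam * a)) := mul_le_mul_of_nonneg_left h4 hK0
    _ = _ := by ring

/-- **Hot-block core.** For weights `p ≥ 0`, levels `a ≥ 0`, `ρ = Σ p > 0`, `E = Σ p a/2` and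
`M ρ < E`: `E √(E/ρ) ≤ K e^{-λM/4} Σ p e^{λ a}` (split the particles at `a = t² = E/ρ`). -/
theorem core {ι : Type*} [Fintype ι] (p a : ι → ℝ) (hp : ∀ i, 0 ≤ p i) (ha : ∀ i, 0 ≤ a i)
    {lam K M ρ E : ℝ} (hlam : 0 < lam) (hK0 : 0 ≤ K)
    (hK : ∀ a : ℝ, 0 ≤ a → (a + a ^ 2) / 2 ≤ K * Real.exp (3 * lam / 4 * a))
    (hρ : 0 < ρ) (hρs : ρ = ∑ i, p i) (hEs : E = ∑ i, p i * (a i / 2)) (hME : M * ρ < E) :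
    E * Real.sqrt (E / ρ) ≤ K * Real.exp (-(lam * M / 4)) * ∑ i, p i * Real.exp (lam * a i) := by
  have hE0 : 0 ≤ E := by
    rw [hEs]; exact Finset.sum_nonneg fun i _ => by have := hp i; have := ha i; positivity
  set t := Real.sqrt (E / ρ)
  have ht0 : 0 ≤ t := Real.sqrt_nonneg _
  have ht2 : t ^ 2 = E / ρ := Real.sq_sqrt (div_nonneg hE0 hρ.le)
  have hMt : M < t ^ 2 := by rw [ht2, lt_div_iff₀ hρ]; exact hME
  let fast : ι → ℝ := fun i => if t ^ 2 < a i then p i * (a i / 2) else 0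
  have hsplit : ∀ i, p i * (a i / 2) ≤ p i * (t ^ 2 / 2) + fast i := by
    intro i
    by_cases h : t ^ 2 < a i
    · simp only [fast, if_pos h]
      have := hp i
      nlinarith [sq_nonneg t]
    · simp only [fast, if_neg h, add_zero]
      push Not at h
      exact mul_le_mul_of_nonneg_left (by linarith) (hp i)
  have hsum : E ≤ ρ * (t ^ 2 / 2) + ∑ i, fast i := by
    rw [hEs, hρs, Finset.sum_mul, ← Finset.sum_add_distrib]
    exact Finset.sum_le_sum fun i _ => hsplit i
  have hρt : ρ * (t ^ 2 / 2) = E / 2 := by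
    rw [ht2]; field_simp
  have hEfast : E ≤ 2 * ∑ i, fast i := by linarith
  have hfast : ∀ i,
      2 * fast i * t ≤ K * Real.exp (-(lam * M / 4)) * (p i * Real.exp (lam * a i)) := by
    intro i
    by_cases h : t ^ 2 < a i
    · simp only [fast, if_pos h]
      have hfb := fast_bound hlam hK0 hK h.le (hMt.trans h).le
      calc 2 * (p i * (a i / 2)) * t = p i * (a i * t) := by ring
        _ ≤ p i * (K * Real.exp (-(lam * M / 4)) * Real.exp (lam * a i)) :=
            mul_le_mul_of_nonneg_left hfb (hp i)
        _ = _ := by ring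
    · simp only [fast, if_neg h, mul_zero, zero_mul]
      have := hp i
      positivity
  calc E * t ≤ (2 * ∑ i, fast i) * t := mul_le_mul_of_nonneg_right hEfast ht0
    _ = ∑ i, 2 * fast i * t := by rw [Finset.mul_sum, Finset.sum_mul]
    _ ≤ ∑ i, K * Real.exp (-(lam * M / 4)) * (p i * Real.exp (lam * a i)) :=
        Finset.sum_le_sum fun i _ => hfast i
    _ = _ := by rw [← Finset.mul_sum]

/-- **Hot-block integrand bound.** With `ρ = Σ p`, `m = Σ p v`, `E = Σ p |v|²/2`, `M ≥ 1`, `M ρ < E`: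
`ρ + |m| + E + E √(E/ρ) ≤ 5 K e^{-λM/4} Σ p e^{λ|v|²}`. -/
theorem integrand_le {ι : Type*} [Fintype ι] (p : ι → ℝ) (v : ι → V3) (hp : ∀ i, 0 ≤ p i)
    {lam K M ρ E : ℝ} {m : V3} (hlam : 0 < lam) (hK0 : 0 ≤ K)
    (hK : ∀ a : ℝ, 0 ≤ a → (a + a ^ 2) / 2 ≤ K * Real.exp (3 * lam / 4 * a))
    (hρ : 0 < ρ) (hρs : ρ = ∑ i, p i)
    (hEs : E = ∑ i, p i * (‖v i‖ ^ 2 / 2)) (hms : m = ∑ i, p i • v i) (hM : 1 ≤ M)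
    (hME : M * ρ < E) :
    ρ + ‖m‖ + E + E * Real.sqrt (E / ρ) ≤
      5 * K * Real.exp (-(lam * M / 4)) * ∑ i, p i * Real.exp (lam * ‖v i‖ ^ 2) := by
  have hcore :=
    core p (fun i => ‖v i‖ ^ 2) hp (fun i => sq_nonneg _) hlam hK0 hK hρ hρs hEs hME
  have hρE : ρ ≤ E := by nlinarith
  have hm : ‖m‖ ≤ ρ / 2 + E := by
    rw [hms, hρs, hEs]
    calc ‖∑ i, p i • v i‖ ≤ ∑ i, ‖p i • v i‖ := norm_sum_le _ _
      _ = ∑ i, p i * ‖v i‖ := Finset.sum_congr rfl fun i _ => by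
          rw [norm_smul, Real.norm_eq_abs, abs_of_nonneg (hp i)]
      _ ≤ ∑ i, (p i / 2 + p i * (‖v i‖ ^ 2 / 2)) := Finset.sum_le_sum fun i _ => by
          nlinarith [sq_nonneg (‖v i‖ - 1), hp i, norm_nonneg (v i)]
      _ = (∑ i, p i) / 2 + ∑ i, p i * (‖v i‖ ^ 2 / 2) := by
          rw [Finset.sum_add_distrib, Finset.sum_div]
  have ht1 : 1 ≤ Real.sqrt (E / ρ) := by
    rw [Real.one_le_sqrt, le_div_iff₀ hρ]; nlinarith
  have hE0 : 0 ≤ E := hρ.le.trans hρE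
  have h5 : ρ + ‖m‖ + E + E * Real.sqrt (E / ρ) ≤ 5 * (E * Real.sqrt (E / ρ)) := by
    nlinarith [mul_le_mul_of_nonneg_left ht1 hE0]
  calc ρ + ‖m‖ + E + E * Real.sqrt (E / ρ) ≤ 5 * (E * Real.sqrt (E / ρ)) := h5
    _ ≤ 5 * (K * Real.exp (-(lam * M / 4)) * ∑ i, p i * Real.exp (lam * ‖v i‖ ^ 2)) :=
        mul_le_mul_of_nonneg_left hcore (by norm_num)
    _ = _ := by ring

end HotCells

open HotCells in
/-- **`engine_hotCells` (registered sub-goal S7 of `stub_engine`): the hot cells are exponentially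
small.** On a band configuration (`ρ̄ ≥ c₁ > 0`), the hot blocks `{Ē > Mρ̄}` (`M ≥ 1`) carry a
total `ρ̄ + |m̄| + Ē + Ē^{3/2}ρ̄^{-1/2}` of at most `C √M e^{−λM/4} ⟨emp w, e^{λ|v|²}⟩`,
`C = C(λ)`. -/
theorem engine_hotCells : ∀ (lam c₁ : ℝ), 0 < lam → 0 < c₁ → ∃ C : ℝ, 0 < C ∧
    ∀ (n : ℕ) (φ : T3 → ℝ), Continuous φ → (∀ y, 0 ≤ φ y) → ∫ y, φ y = 1 →
    ∀ w : Config (n + 1) (Fin 3) T3, (∀ x, c₁ ≤ bρ φ w x) → ∀ M : ℝ, 1 ≤ M →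
      ∫ x in {x | M * bρ φ w x < bE φ w x},
          (bρ φ w x + ‖bm φ w x‖ + bE φ w x + bE φ w x * Real.sqrt (bE φ w x / bρ φ w x)) ≤
        C * Real.sqrt M * Real.exp (-(lam * M / 4)) * ∫ y, Real.exp (lam * ‖y.2‖ ^ 2) ∂(empiricalMeasure w) := by
  intro lam c₁ hlam hc₁
  obtain ⟨K, hK, hKle⟩ := exists_half_add_sq_le hlam
  refine ⟨5 * K, by positivity, ?_⟩
  intro n φ hφc hφ0 hφ1 w hband M hM
  -- the dominating block functional `G(x) = Σᵢ pᵢ(x) e^{λ|vᵢ|²}`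
  set G : T3 → ℝ := fun x =>
    ∑ i, ((n + 1 : ℕ) : ℝ)⁻¹ * φ ((w i).1 - x) * Real.exp (lam * ‖(w i).2‖ ^ 2) with hG
  -- the block fields as finite sums with weights `pᵢ(x) = (n+1)⁻¹ φ(xᵢ − x)`
  have hρ_eq : ∀ x, bρ φ w x = ∑ i, ((n + 1 : ℕ) : ℝ)⁻¹ * φ ((w i).1 - x) := fun x => by
    rw [bρ_eq_sum, Finset.mul_sum]
  have hE_eq : ∀ x,
      bE φ w x = ∑ i, ((n + 1 : ℕ) : ℝ)⁻¹ * φ ((w i).1 - x) * (‖(w i).2‖ ^ 2 / 2) := fun x => by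
    rw [bE_eq_sum, Finset.mul_sum]
    simp only [mul_assoc]
  have hm_eq : ∀ x,
      bm φ w x = ∑ i, (((n + 1 : ℕ) : ℝ)⁻¹ * φ ((w i).1 - x)) • (w i).2 := fun x => by
    simp only [bm, empiricalMomentumField]
    rw [integral_empiricalMeasure_V3, Finset.smul_sum]
    simp only [smul_smul]
  have hp0 : ∀ (x : T3) (i : Fin (n + 1)), 0 ≤ ((n + 1 : ℕ) : ℝ)⁻¹ * φ ((w i).1 - x) :=
    fun x i => by
      have := hφ0 ((w i).1 - x); positivity
  -- pointwise bound on the hot set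
  have hpt : ∀ x ∈ {x | M * bρ φ w x < bE φ w x},
      bρ φ w x + ‖bm φ w x‖ + bE φ w x + bE φ w x * Real.sqrt (bE φ w x / bρ φ w x) ≤
        5 * K * Real.exp (-(lam * M / 4)) * G x := fun x hx =>
    integrand_le (fun i => ((n + 1 : ℕ) : ℝ)⁻¹ * φ ((w i).1 - x)) (fun i => (w i).2) (hp0 x) hlam hK.le
      hKle (hc₁.trans_le (hband x)) (hρ_eq x) (hE_eq x) (hm_eq x) hM hx
  -- non-negativity of the integrand, everywhere
  have hE0 : ∀ x, 0 ≤ bE φ w x := fun x => by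
    rw [hE_eq]; exact Finset.sum_nonneg fun i _ => by have := hp0 x i; positivity
  have hnn : ∀ x,
      0 ≤ bρ φ w x + ‖bm φ w x‖ + bE φ w x + bE φ w x * Real.sqrt (bE φ w x / bρ φ w x) :=
    fun x => by
      have h1 : 0 ≤ bρ φ w x := hc₁.le.trans (hband x)
      have h2 := hE0 x
      positivity
  -- continuity: the hot set is measurable, `G` is integrable
  have hcontφ : ∀ i : Fin (n + 1), Continuous fun x => ((n + 1 : ℕ) : ℝ)⁻¹ * φ ((w i).1 - x) :=
    fun i => continuous_const.mul (hφc.comp (continuous_const.sub continuous_id))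
  have hρc : Continuous (bρ φ w) := by
    rw [show bρ φ w = fun x => ∑ i, ((n + 1 : ℕ) : ℝ)⁻¹ * φ ((w i).1 - x) from funext hρ_eq]
    exact continuous_finsetSum _ fun i _ => hcontφ i
  have hEc : Continuous (bE φ w) := by
    rw [show bE φ w = fun x => ∑ i, ((n + 1 : ℕ) : ℝ)⁻¹ * φ ((w i).1 - x) * (‖(w i).2‖ ^ 2 / 2) from
      funext hE_eq]
    exact continuous_finsetSum _ fun i _ => (hcontφ i).mul continuous_const
  have hH : MeasurableSet {x | M * bρ φ w x < bE φ w x} :=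
    measurableSet_lt (continuous_const.mul hρc).measurable hEc.measurable
  have hGi : Integrable G :=
    integrable_of_continuous_T3 (continuous_finsetSum _ fun i _ => (hcontφ i).mul continuous_const)
  have hG0 : ∀ x, 0 ≤ G x := fun x =>
    Finset.sum_nonneg fun i _ => by have := hp0 x i; positivity
  -- `∫ G = ⟨emp w, e^{λ|v|²}⟩`
  have hGint : ∫ x, G x = ∫ y, Real.exp (lam * ‖y.2‖ ^ 2) ∂(empiricalMeasure w) := by
    rw [integral_empiricalMeasure, hG, integral_finsetSum _ fun i _ => ?_]
    · rw [Finset.mul_sum]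
      refine Finset.sum_congr rfl fun i _ => ?_
      rw [integral_mul_const, integral_const_mul, MesoLLN.integral_comp_sub_left φ _, hφ1]
      ring
    · exact integrable_of_continuous_T3 ((hcontφ i).mul continuous_const)
  -- assemble
  have hgi : Integrable fun x => 5 * K * Real.exp (-(lam * M / 4)) * G x := hGi.const_mul _
  have h1M : 1 ≤ Real.sqrt M := Real.one_le_sqrt.2 hM
  have hI : 0 ≤ ∫ y, Real.exp (lam * ‖y.2‖ ^ 2) ∂(empiricalMeasure w) :=
    integral_nonneg fun _ => (Real.exp_pos _).le
  calc ∫ x in {x | M * bρ φ w x < bE φ w x},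
        (bρ φ w x + ‖bm φ w x‖ + bE φ w x + bE φ w x * Real.sqrt (bE φ w x / bρ φ w x))
      ≤ ∫ x in {x | M * bρ φ w x < bE φ w x}, 5 * K * Real.exp (-(lam * M / 4)) * G x :=
        integral_mono_of_nonneg (ae_of_all _ hnn) hgi.integrableOn
          (ae_restrict_of_forall_mem hH hpt)
    _ ≤ ∫ x, 5 * K * Real.exp (-(lam * M / 4)) * G x :=
        setIntegral_le_integral hgi (ae_of_all _ fun x => by have := hG0 x; positivity)
    _ = 5 * K * Real.exp (-(lam * M / 4)) *
          ∫ y, Real.exp (lam * ‖y.2‖ ^ 2) ∂(empiricalMeasure w) := by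
        rw [integral_const_mul, hGint]
    _ = 1 * (5 * K * Real.exp (-(lam * M / 4)) *
          ∫ y, Real.exp (lam * ‖y.2‖ ^ 2) ∂(empiricalMeasure w)) := by ring
    _ ≤ Real.sqrt M * (5 * K * Real.exp (-(lam * M / 4)) *
          ∫ y, Real.exp (lam * ‖y.2‖ ^ 2) ∂(empiricalMeasure w)) :=
        mul_le_mul_of_nonneg_right h1M (by positivity)
    _ = 5 * K * Real.sqrt M * Real.exp (-(lam * M / 4)) *
          ∫ y, Real.exp (lam * ‖y.2‖ ^ 2) ∂(empiricalMeasure w) := by ring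

end Barycentric

end Summit.AtomisticToContinuum.HydrodynamicLimit.Theorems.MacroClosureLine

end
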